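import Literature.Barriers.FinalStateConjecture.NonSmoothNullInfinityCorrectedProofs
import Literature.Barriers.FinalStateConjecture.NonSmoothNullInfinityRadius
import Mathlib.Analysis.Calculus.BumpFunction.InnerProduct
import Mathlib.Analysis.Calculus.BumpFunction.Normed
import Mathlib.MeasureTheory.Measure.Lebesgue.EqHaar
import HarnessLib

/-!
# Barrier catalogue `FinalStateConjecture`: the journal-sign declaration
# `KehrbergerLogarithmicAsymptotics` is false (refutation, proved)
(`Literature/Barriers/FinalStateConjecture/`, D-0021, D-0014; family `gr`; namespace
`Literature.Barriers.FinalStateConjecture`)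

`NonSmoothNullInfinity.lean` keeps two transcriptions of Kehrberger's Thm. 6.2 ("The case against
smooth null infinity I", Ann. Henri Poincaré 23 (2022) 829–921 = arXiv:2105.08079), eq. (6.18):
`KehrbergerLogarithmicAsymptotics` with the logarithmic coefficient `+(−1)ⁿ(3+n)! I⁽ⁿ⁾[G] M` of
arXiv v1–v2 and the journal, and `KehrbergerLogarithmicAsymptoticsCorrected` with the author-corrected
sign `−(−1)ⁿ(3+n)! I⁽ⁿ⁾[G] M` of arXiv v3 (2023, comments field: "(the same) sign mistake in eqns.
(4.45), (6.5), (6.18), and (B.2) fixed"). The erratum paragraph of the old declaration says it is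
"presumably false as stated". This file **proves** that it is false (and since the verdict
clean-up of 2026-08-15 the old declaration is `@[deprecated KehrbergerLogarithmicAsymptoticsCorrected]`,
kept verbatim only as the subject of this refutation, with a docstring pointing here):

* the corrected fact is a theorem (`KehrbergerLogarithmicAsymptoticsCorrected_holds`,
  `NonSmoothNullInfinityCorrectedProofs.lean`);
* the radiation field asserted by either declaration is THE scattering solution: smooth radiation
  fields vanishing on `{v ≤ v₁}` with the same pointwise data on `𝓘⁻` coincide
  (`IsRadiationFieldOnSchwarzschild.unique`, `NonSmoothNullInfinityProofs.lean`);
* for one radiation field and one retarded time the two signs of clause (2) exclude each other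
  (`KehrbergerLogarithmicAsymptotics.clause_two_exclusive`, `NonSmoothNullInfinity.lean`).

Instantiating both declarations at `M = 1`, the EF area radius `efAreaRadius 1 (v − u)`
(`isEFAreaRadius_efAreaRadius`), a smooth bump `G` supported in `[−2, 2] ⊆ (−3, 3)` with `∫ G > 0`
(Mathlib's `ContDiffBump`), and `n = 0` (`I⁽⁰⁾[G] = ∫ G ≠ 0`), gives `False`. Nothing here touches the
barrier's bite (`KehrbergerLogarithmicAsymptoticsCorrected.not_conformallySmooth`), which is
sign-independent and now unconditional.

## References

* L. M. A. Kehrberger, *The case against smooth null infinity I: heuristics and counter-examples*,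
  Ann. Henri Poincaré 23 (2022) 829–921 = arXiv:2105.08079; v3 (29 Sep 2023) for the corrected sign of
  eq. (6.18). Key `Kehrberger2022AHP`.
-/

noncomputable section

open MeasureTheory Set Filter Topology Asymptotics Finset

namespace Literature.Barriers.FinalStateConjecture

-- `KehrbergerLogarithmicAsymptotics` is `@[deprecated]` in `NonSmoothNullInfinity.lean` (mis-stated,
-- refuted; verdict clean-up 2026-08-15) and its refutation below must name it;
-- REMOVE-WHEN the deprecated def is deleted.
set_option linter.deprecated false in
/-- **Refutation of the journal-sign declaration `KehrbergerLogarithmicAsymptotics`.** The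
transcription of Kehrberger's Thm. 6.2, eq. (6.18), with the logarithmic coefficient
`+(−1)ⁿ(3+n)! I⁽ⁿ⁾[G] M` printed in arXiv v1–v2 and in Ann. Henri Poincaré 23 (2022) is false: at
`M = 1`, `r = efAreaRadius 1 (v − u)`, a smooth bump `G ≥ 0` supported in `[−2, 2] ⊆ (−3, 3)` with
`∫ G > 0` and `n = 0`, the radiation field it asserts is, by uniqueness of the scattering solution
(`IsRadiationFieldOnSchwarzschild.unique`), the one of the author-corrected theorem
`KehrbergerLogarithmicAsymptoticsCorrected_holds` (arXiv:2105.08079v3: "sign mistake in eqns. (4.45),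
(6.5), (6.18), and (B.2) fixed"), whose expansion towards `𝓘⁺` carries the opposite logarithmic
coefficient; the two expansions exclude each other
(`KehrbergerLogarithmicAsymptotics.clause_two_exclusive`). Use
`KehrbergerLogarithmicAsymptoticsCorrected` (a theorem) instead; the barrier's bite
`…Corrected.not_conformallySmooth` is unaffected.
[cite: Kehrberger2022AHP, Thm. 6.2 eq. (6.18), arXiv v1–v2 versus v3] -/
theorem not_KehrbergerLogarithmicAsymptotics : ¬ KehrbergerLogarithmicAsymptotics := by
  intro h
  have hM : (0 : ℝ) < 1 := one_pos
  have hr : IsEFAreaRadius 1 (fun u v ↦ efAreaRadius 1 (v - u - 0)) := isEFAreaRadius_efAreaRadius hM 0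
  -- the data: a smooth bump supported in `[-2, 2]`, positive integral
  let B : ContDiffBump (0 : ℝ) := ⟨1, 2, one_pos, one_lt_two⟩
  have hG : ContDiff ℝ ((⊤ : ℕ∞) : WithTop ℕ∞) (B : ℝ → ℝ) := B.contDiff
  have hrOut : B.rOut = 2 := rfl
  have hsupp : tsupport (B : ℝ → ℝ) ⊆ Ioo (-3 : ℝ) 3 := by
    rw [B.tsupport_eq, hrOut, Real.closedBall_eq_Icc]
    intro x hx
    exact ⟨by linarith [hx.1], by linarith [hx.2]⟩
  have hv : (-3 : ℝ) < 3 := by norm_num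
  have hn : kehrbergerMoment 1 (B : ℝ → ℝ) 0 ≠ 0 := by
    rw [kehrbergerMoment_zero, one_mul]
    exact (B.integral_pos (μ := volume)).ne'
  have hlt : ∀ k < 0, kehrbergerMoment 1 (B : ℝ → ℝ) k = 0 := fun k hk ↦ absurd hk (Nat.not_lt_zero k)
  -- the two radiation fields
  obtain ⟨ψ, hψ, hz, hlim, U₀, hU₀, -, f, -, hexp⟩ :=
    h 1 hM _ hr (B : ℝ → ℝ) (-3) 3 hv hG hsupp 0 hlt hn
  obtain ⟨ψ', hψ', hz', hlim', U₀', -, -, f', -, hexp'⟩ :=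
    KehrbergerLogarithmicAsymptoticsCorrected_holds 1 hM _ hr (B : ℝ → ℝ) (-3) 3 hv hG hsupp 0 hlt hn
  -- they coincide
  have heq : ψ = ψ' := IsRadiationFieldOnSchwarzschild.unique hM hr hψ hψ' hz hz' hlim hlim'
  subst heq
  -- a retarded time below both thresholds
  set u : ℝ := min U₀ U₀' - 1 with hu_def
  have hu : u < U₀ := by have := min_le_left U₀ U₀'; linarith
  have hu' : u < U₀' := by have := min_le_right U₀ U₀'; linarith
  have hc : (-1 : ℝ) ^ 0 * ((0 + 3).factorial : ℝ) * kehrbergerMoment 1 (B : ℝ → ℝ) 0 * 1 ≠ 0 := by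
    rw [pow_zero, one_mul, mul_one]
    exact mul_ne_zero (by positivity) hn
  exact KehrbergerLogarithmicAsymptotics.clause_two_exclusive hM.le hr hc
    (f := fun i ↦ f i u) (g := fun i ↦ f' i u) (hexp u hu) (hexp' u hu')

end Literature.Barriers.FinalStateConjecture

end
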